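import Literature.Computability.AlgebraicComplexity.AsymptoticSumInequality
import Literature.Computability.AlgebraicComplexity.CoppersmithWinograd1990Proofs
import HarnessLib

/-!
# Schönhage's asymptotic sum inequality for the asymptotic rank
(Alman–Duan–Vassilevska Williams–Xu–Xu–Zhou 2025, Thm. 3.1; BCS 1997, Ex. 15.24(7)) — proved

Topic `Literature/Computability/AlgebraicComplexity`.  The tree proves Schönhage's `τ`-theorem for the
rank (`asymptoticSumInequality_rank`, `AsymptoticSumInequality.lean`) and for the border rank
(`Blaser2013_thm75_holds`, `SchoenhageTauDischarge.lean`), and its asymptotic-rank form for EQUAL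
summands (`SchonhageRectangular.lean`, ADVXXZ Thm. 3.2).  This file proves the strongest classical
form, with the asymptotic rank `R̃ ≤ bR ≤ R` of an arbitrary direct sum of matrix tensors in the
hypothesis, as stated by Alman–Duan–Vassilevska Williams–Xu–Xu–Zhou (SODA 2025 = arXiv:2404.16349,
§3.5):

> **Theorem 3.1 (Asymptotic Sum Inequality [Schönhage 1981]).** For positive integers `r > m` and
> `aᵢ, bᵢ, cᵢ` (`i ∈ [m]`), if `R̃(⊕_{i=1}^m ⟨aᵢ, bᵢ, cᵢ⟩) ≤ r` then `ω ≤ 3τ`, where `τ ∈ [2/3, 1]` is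
> the solution to `∑_{i=1}^m (aᵢ bᵢ cᵢ)^τ = r`.

* `sum_rpow_pow_le_of_tensorRank_kroneckerPow_le` — `(∑ᵢ (kᵢmᵢnᵢ)^{ω/3})^N ≤ 2 (N+1)^p Q` whenever
  `R((⊕ᵢ ⟨kᵢ,mᵢ,nᵢ⟩)^{⊗N}) ≤ Q` (the type-class estimate of Bläser 2013, proof of Thm. 7.5, with an
  arbitrary bound `Q` on the rank of the power in place of `R(D)^N`);
* `sum_rpow_omega_le_asymptoticRank` — **`∑ᵢ (kᵢ mᵢ nᵢ)^{ω/3} ≤ R̃(⊕ᵢ ⟨kᵢ, mᵢ, nᵢ⟩)`** over any field;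
* `advxxz2025_thm31` — the printed `τ`-form: `p < r`, `R̃(⊕ᵢ ⟨kᵢ,mᵢ,nᵢ⟩) ≤ r`, `∑ (kᵢmᵢnᵢ)^τ = r`
  `⇒ ω ≤ 3τ`.

Proof: if `R(D^{⊗n})^{1/n} < c < S = ∑ (kᵢmᵢnᵢ)^{ω/3}` for some `n ≥ 1` (which happens as soon as
`R̃(D) < S`, `R̃` being the infimum), then `R(D^{⊗nj}) ≤ R(D^{⊗n})^j < c^{nj}` for all `j`
(`tensorRank_kroneckerPow_mul_le_pow`), so `S^{nj} ≤ 2(nj+1)^p c^{nj}`, i.e. `(S/c)^{nj} ≤ 2(nj+1)^p`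
for all `j` — impossible since `S/c > 1`.  No definitions, no named facts.

## References

* J. Alman, R. Duan, V. Vassilevska Williams, Y. Xu, Z. Xu, R. Zhou, *More asymmetry yields faster
  matrix multiplication*, SODA 2025 = arXiv:2404.16349, §3.5, Thm. 3.1.
  [AlmanDuanVassilevskaWilliamsXuXuZhou2025]
* M. Bläser, *Fast Matrix Multiplication*, ToC Graduate Surveys 5 (2013), Thm. 7.5 and its proof
  (pp. 32–34). [Blaser2013]
* P. Bürgisser, M. Clausen, M. A. Shokrollahi, *Algebraic Complexity Theory* (1997), (15.11) and
  Ex. 15.24(7) (asymptotic rank in place of border rank). [BurgisserClausenShokrollahi1997]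
* A. Schönhage, *Partial and total matrix multiplication*, SIAM J. Comput. 10 (1981) 434–455.
-/

noncomputable section

open scoped BigOperators
open Filter Topology

namespace Literature.Computability.AlgebraicComplexity

universe u

/-! ## The type-class estimate with an arbitrary rank bound -/

section ClassBound

variable (K : Type u) [Field K] {p : ℕ} (k m n : Fin p → ℕ)

/-- One type class contributes at most `2Q` when `R(D^{⊗N}) ≤ Q` (as `card_mul_rpow_le_of_class`,
with `Q` for `rᴺ`): `F · (K'M'N')^{ω/3} ≤ 2Q`. [cite: Blaser2013, Thm. 7.5 (proof)] -/
theorem card_mul_rpow_le_of_class_of_le {N F K' M' N' Q : ℕ}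
    (hD : tensorRank (kroneckerPow (matMulDirectSum K k m n) N) ≤ Q)
    (rep : Fin F → (Fin N → Fin p)) (hrep : Function.Injective rep)
    (hK : ∀ β, ∏ j, k (rep β j) = K') (hM : ∀ β, ∏ j, m (rep β j) = M')
    (hN : ∀ β, ∏ j, n (rep β j) = N') :
    (F : ℝ) * ((K' * M' * N' : ℕ) : ℝ) ^ (omega K / 3) ≤ 2 * (Q : ℝ) := by
  have hω : omega K / 3 ≠ 0 := by
    have := omega_two_le (K := K); positivity
  have hle : tensorRank (kroneckerTensor (unitTensor K F) (matMulTensor K K' M' N')) ≤ Q :=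
    (tensorRank_multiple_le_kroneckerPow_matMulDirectSum K k m n rep hrep hK hM hN).trans hD
  rcases Nat.eq_zero_or_pos (K' * M' * N') with h0 | hpos
  · rw [h0, Nat.cast_zero, Real.zero_rpow hω, mul_zero]
    positivity
  have hK' : 0 < K' := Nat.pos_of_ne_zero fun h => by simp [h] at hpos
  have hM' : 0 < M' := Nat.pos_of_ne_zero fun h => by simp [h] at hpos
  have hN' : 0 < N' := Nat.pos_of_ne_zero fun h => by simp [h] at hpos
  have hF : F ≤ Q := by
    refine le_trans (le_tensorRank_multiple F (matMulTensor K K' M' N')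
      (a₀ := (⟨0, hK'⟩, ⟨0, hN'⟩)) (b₀ := (⟨0, hK'⟩, ⟨0, hM'⟩)) (c₀ := (⟨0, hM'⟩, ⟨0, hN'⟩)) ?_) hle
    simp [matMulTensor]
  have hFr : (F : ℝ) ≤ (Q : ℝ) := by exact_mod_cast hF
  rcases Nat.eq_or_lt_of_le hpos with h1 | h2
  · rw [← h1, Nat.cast_one, Real.one_rpow, mul_one]
    have : (0 : ℝ) ≤ (Q : ℝ) := by positivity
    linarith
  · rcases Nat.eq_zero_or_pos F with hF0 | hFpos
    · rw [hF0, Nat.cast_zero, zero_mul]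
      positivity
    set q : ℕ := Q / F + 1 with hq
    have hqF : Q ≤ q * F := by
      rw [hq, Nat.add_mul, one_mul, mul_comm]
      have := Nat.div_add_mod Q F
      have := Nat.mod_lt Q hFpos
      omega
    have h77 := Blaser2013_lemma77_rpow K hFpos h2 (hle.trans hqF)
    have hqF' : (F : ℝ) * q ≤ 2 * (Q : ℝ) := by
      have h3 : F * q ≤ Q + F := by
        rw [hq, Nat.mul_add, mul_one]
        exact Nat.add_le_add_right (Nat.mul_div_le Q F) F
      have h4 : ((F * q : ℕ) : ℝ) ≤ ((Q + F : ℕ) : ℝ) := by exact_mod_cast h3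
      push_cast at h4
      linarith
    calc (F : ℝ) * ((K' * M' * N' : ℕ) : ℝ) ^ (omega K / 3) ≤ (F : ℝ) * q :=
        mul_le_mul_of_nonneg_left h77 (Nat.cast_nonneg _)
      _ ≤ 2 * (Q : ℝ) := hqF'

/-- **`(∑ᵢ (kᵢmᵢnᵢ)^{ω/3})ᴺ ≤ 2 (N+1)ᵖ Q` whenever `R((⊕ᵢ ⟨kᵢ,mᵢ,nᵢ⟩)^{⊗N}) ≤ Q`** (as
`sum_rpow_pow_le`, with an arbitrary bound on the rank of the power). [cite: Blaser2013, Thm. 7.5 (proof)] -/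
theorem sum_rpow_pow_le_of_tensorRank_kroneckerPow_le {N Q : ℕ}
    (hD : tensorRank (kroneckerPow (matMulDirectSum K k m n) N) ≤ Q) :
    (∑ i, ((k i * m i * n i : ℕ) : ℝ) ^ (omega K / 3)) ^ N ≤ 2 * ((N : ℝ) + 1) ^ p * (Q : ℝ) := by
  classical
  set X : (Fin N → Fin p) → ℝ := fun τ =>
    (((∏ j, k (τ j)) * (∏ j, m (τ j)) * (∏ j, n (τ j)) : ℕ) : ℝ) ^ (omega K / 3) with hX
  have hexpand : (∑ i, ((k i * m i * n i : ℕ) : ℝ) ^ (omega K / 3)) ^ N = ∑ τ : Fin N → Fin p, X τ := by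
    rw [Fintype.sum_pow]
    refine Finset.sum_congr rfl fun τ _ => ?_
    rw [hX]
    dsimp only
    rw [Real.finsetProd_rpow _ _ (fun i _ => by positivity)]
    congr 1
    push_cast
    rw [Finset.prod_mul_distrib, Finset.prod_mul_distrib]
  obtain ⟨wt, hwt⟩ : ∃ wt : (Fin N → Fin p) → (Fin p → Fin (N + 1)),
      ∀ τ i, ((wt τ i : Fin (N + 1)) : ℕ) = (Finset.univ.filter fun j => τ j = i).card :=
    ⟨fun τ i => ⟨(Finset.univ.filter fun j => τ j = i).card,
      Nat.lt_succ_of_le ((Finset.card_filter_le _ _).trans (by simp))⟩, fun τ i => rfl⟩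
  rw [hexpand, ← Finset.sum_fiberwise Finset.univ wt X]
  have hclass : ∀ c : Fin p → Fin (N + 1),
      ∑ τ ∈ Finset.univ.filter (fun τ => wt τ = c), X τ ≤ 2 * (Q : ℝ) := by
    intro c
    set S := Finset.univ.filter (fun τ : Fin N → Fin p => wt τ = c) with hS
    rcases S.eq_empty_or_nonempty with hemp | ⟨τ₀, hτ₀⟩
    · rw [hemp, Finset.sum_empty]
      positivity
    have hmem : ∀ τ ∈ S, ∀ i, (Finset.univ.filter fun j => τ j = i).card =
        (Finset.univ.filter fun j => τ₀ j = i).card := fun τ hτ i => by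
      rw [← hwt, ← hwt, (Finset.mem_filter.1 hτ).2, (Finset.mem_filter.1 hτ₀).2]
    have hconst : ∀ τ ∈ S, X τ = X τ₀ := fun τ hτ => by
      simp only [hX]
      rw [prod_eq_of_card_filter_eq (hmem τ hτ) k, prod_eq_of_card_filter_eq (hmem τ hτ) m,
        prod_eq_of_card_filter_eq (hmem τ hτ) n]
    rw [Finset.sum_congr rfl hconst, Finset.sum_const, nsmul_eq_mul]
    set rep : Fin S.card → (Fin N → Fin p) := fun β => (S.equivFin.symm β).1 with hrep
    have hrep_mem : ∀ β, rep β ∈ S := fun β => (S.equivFin.symm β).2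
    have hinj : Function.Injective rep := fun β β' hβ =>
      S.equivFin.symm.injective (Subtype.ext hβ)
    exact card_mul_rpow_le_of_class_of_le K k m n hD rep hinj
      (fun β => prod_eq_of_card_filter_eq (hmem _ (hrep_mem β)) k)
      (fun β => prod_eq_of_card_filter_eq (hmem _ (hrep_mem β)) m)
      (fun β => prod_eq_of_card_filter_eq (hmem _ (hrep_mem β)) n)
  calc ∑ c : Fin p → Fin (N + 1), ∑ τ ∈ Finset.univ.filter (fun τ => wt τ = c), X τ
      ≤ ∑ _c : Fin p → Fin (N + 1), 2 * (Q : ℝ) := Finset.sum_le_sum fun c _ => hclass c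
    _ = 2 * ((N : ℝ) + 1) ^ p * (Q : ℝ) := by
      rw [Finset.sum_const, Finset.card_univ, Fintype.card_fun, Fintype.card_fin, Fintype.card_fin,
        nsmul_eq_mul]
      push_cast
      ring

end ClassBound

/-! ## The asymptotic sum inequality for the asymptotic rank -/

section ASI

variable (K : Type u) [Field K] {p : ℕ} (k m n : Fin p → ℕ)

/-- **Schönhage's asymptotic sum inequality, asymptotic-rank version**:
`∑ᵢ (kᵢ mᵢ nᵢ)^{ω/3} ≤ R̃(⊕ᵢ ⟨kᵢ, mᵢ, nᵢ⟩)` over any field (BCS Ex. 15.24(7): in (15.11) and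
Thm. 15.41 the border rank may be replaced by the asymptotic rank; ADVXXZ Thm. 3.1).
[cite: AlmanDuanVassilevskaWilliamsXuXuZhou2025, Thm. 3.1] [cite: BurgisserClausenShokrollahi1997, Ex. 15.24(7)] -/
theorem sum_rpow_omega_le_asymptoticRank :
    ∑ i, ((k i * m i * n i : ℕ) : ℝ) ^ (omega K / 3) ≤ asymptoticRank (matMulDirectSum K k m n) := by
  classical
  set D := matMulDirectSum K k m n with hD
  set S : ℝ := ∑ i, ((k i * m i * n i : ℕ) : ℝ) ^ (omega K / 3) with hS
  have hS0 : 0 ≤ S := Finset.sum_nonneg fun i _ => by positivity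
  by_contra hlt
  rw [not_le] at hlt
  have hR0 : 0 ≤ asymptoticRank D := asymptoticRank_nonneg D
  -- a level `c` strictly between `R̃(D)` and `S`
  set c : ℝ := (asymptoticRank D + S) / 2 with hc
  have hRc : asymptoticRank D < c := by rw [hc]; linarith
  have hcS : c < S := by rw [hc]; linarith
  have hc0 : 0 < c := by rw [hc]; linarith
  -- some power has small rank: `R(D^{⊗(N+1)})^{1/(N+1)} < c`
  have hbdd : BddBelow (Set.range fun N : ℕ =>
      ((tensorRank (kroneckerPow D (N + 1)) : ℝ) ^ ((N : ℝ) + 1)⁻¹)) :=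
    ⟨0, by rintro _ ⟨N, rfl⟩; positivity⟩
  obtain ⟨N, hN⟩ := exists_lt_of_ciInf_lt (f := fun N : ℕ =>
    ((tensorRank (kroneckerPow D (N + 1)) : ℝ) ^ ((N : ℝ) + 1)⁻¹)) hRc
  set ν : ℕ := N + 1 with hν
  have hν0 : 0 < ν := Nat.succ_pos N
  have hν0' : (0 : ℝ) < ν := by exact_mod_cast hν0
  set ρ : ℕ := tensorRank (kroneckerPow D ν) with hρ
  -- `ρ < c^ν`
  have hρc : (ρ : ℝ) < c ^ (ν : ℝ) := by
    have hνr : ((N : ℝ) + 1) = ν := by rw [hν]; push_cast; ring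
    have h1 : ((ρ : ℝ) ^ ((ν : ℝ))⁻¹) < c := by rw [← hνr]; exact hN
    have h2 : ((ρ : ℝ) ^ ((ν : ℝ))⁻¹) ^ (ν : ℝ) < c ^ (ν : ℝ) :=
      Real.rpow_lt_rpow (by positivity) h1 hν0'
    rwa [Real.rpow_inv_rpow (Nat.cast_nonneg _) hν0'.ne'] at h2
  -- along the multiples `ν j`: `S^{ν j} ≤ 2 (ν j + 1)^p ρ^j ≤ 2 (ν j + 1)^p c^{ν j}`
  set a : ℝ := S / c with ha
  have ha1 : 1 < a := (one_lt_div hc0).2 hcS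
  have ha0 : 0 < a := zero_lt_one.trans ha1
  have hSa : S = a * c := by rw [ha, div_mul_cancel₀ _ hc0.ne']
  have hpow : ∀ j : ℕ, a ^ (ν * j) ≤ 2 * (((ν * j : ℕ) : ℝ) + 1) ^ p := by
    intro j
    have hDj : tensorRank (kroneckerPow D (ν * j)) ≤ ρ ^ j := tensorRank_kroneckerPow_mul_le_pow D ν j
    have h1 := sum_rpow_pow_le_of_tensorRank_kroneckerPow_le K k m n hDj
    rw [← hS] at h1
    have hρj : ((ρ ^ j : ℕ) : ℝ) ≤ c ^ (ν * j) := by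
      push_cast
      have : (ρ : ℝ) ^ j ≤ (c ^ (ν : ℝ)) ^ j := pow_le_pow_left₀ (Nat.cast_nonneg _) hρc.le j
      rwa [Real.rpow_natCast, ← pow_mul] at this
    have h2 : S ^ (ν * j) ≤ 2 * (((ν * j : ℕ) : ℝ) + 1) ^ p * c ^ (ν * j) :=
      h1.trans (mul_le_mul_of_nonneg_left hρj (by positivity))
    rw [hSa, mul_pow] at h2
    exact le_of_mul_le_mul_right (by linarith) (pow_pos hc0 _)
  -- but `(ν j + 1)^p / a^{ν j} → 0`
  have hlim : Tendsto (fun j : ℕ => (((ν * j + 1 : ℕ) : ℝ)) ^ p / a ^ (ν * j + 1)) atTop (𝓝 0) := by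
    have ht : Tendsto (fun j : ℕ => ν * j + 1) atTop atTop := by
      refine tendsto_atTop_mono (fun j => ?_) tendsto_id
      show j ≤ ν * j + 1
      nlinarith
    exact (tendsto_pow_const_div_const_pow_of_one_lt p ha1).comp ht
  have hsmall : (0 : ℝ) < 1 / (2 * a) := by positivity
  obtain ⟨j, hj⟩ := (hlim.eventually (gt_mem_nhds hsmall)).exists
  rw [div_lt_div_iff₀ (by positivity) (by positivity), one_mul, pow_succ] at hj
  have h2 := mul_le_mul_of_nonneg_right (hpow j) ha0.le
  push_cast at hj h2
  linarith

/-- **ADVXXZ Theorem 3.1 (Asymptotic Sum Inequality [Schönhage 1981]), as printed**: for `r > p` and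
positive integers `kᵢ, mᵢ, nᵢ`, if `R̃(⊕_{i<p} ⟨kᵢ, mᵢ, nᵢ⟩) ≤ r` then `ω ≤ 3τ` where
`∑ᵢ (kᵢ mᵢ nᵢ)^τ = r`. [cite: AlmanDuanVassilevskaWilliamsXuXuZhou2025, Thm. 3.1] -/
theorem advxxz2025_thm31 {r : ℕ} (hpr : p < r)
    (h : asymptoticRank (matMulDirectSum K k m n) ≤ r) {τ : ℝ}
    (hτ : ∑ i, ((k i * m i * n i : ℕ) : ℝ) ^ τ = r) : omega K ≤ 3 * τ :=
  omega_le_three_mul_of_sum_rpow_omega_le K k m n hpr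
    ((sum_rpow_omega_le_asymptoticRank K k m n).trans h) hτ

end ASI

end Literature.Computability.AlgebraicComplexity

end
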